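import Mathlib
import Summits.ResolutionOfSingularities.ResolutionOfSingularities.Theorems.WildQuotientsWildQuotientResolutionTwoBlocksCentreStable

/-!
# V4U-1: the weighted ideal `I₆ = (x_a², x_a x_b², x_a x_b x_c, x_a x_c³, x_b³, x_b² x_c², x_b x_c⁴, x_c⁶)` is `⟨J₄⟩`-stable

(crux stmt-ResolutionOfSingularities-15640 `WildQuotients.WildQuotientResolution`, line `Sketch`,
sector `|G| = p`; programme V4U of `L/w45c/CHAIN.md` v5 (plan-1 RULING v5.1 2026-08-27T02:09:03Z (5),
«stub-4's V4U-1 = `JordanFour.smul_I6_eq` + `I6_blowup_integral_proper_birational`»; stub-4 FINDING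
V4U-Q3 01:48:51Z). [OURS · L1 W4.5c] — NOT a statement of any manuscript; replaces the role of no printed
item. Prover res-L1-w45c-stub-4.)

`I₆ = {x_a^i x_b^j x_c^l : 3i + 2j + l ≥ 6}` is the weight-`6` piece of the `(3,2,1)`-filtration on
`(x_a, x_b, x_c)`; its blow-up is the `(3,2,1)`-weighted blow-up of `𝔸ⁿ` along `V(x_a, x_b, x_c)` (the
Veronese `⊕ I_{6m}` of `⊕ I_n` is standard-graded, FINDING V4U-Q3). VECTOR OF RECORD (stub-2 02:40:13Z):
`![X a ^ 2, X a * X b ^ 2, X a * X b * X c, X a * X c ^ 3, X b ^ 3, X b ^ 2 * X c ^ 2, X b * X c ^ 4, X c ^ 6]`.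

Method (no binomial expansions): the weight ideals `W_w = (x_a^i x_b^j x_c^l : 3i+2j+l ≥ w)` satisfy
`W_v W_w ⊆ W_{v+w}`, `W₆ ⊆ I₆`; a ring endomorphism `τ` with `τ x_a = x_a`, `τ x_b = x_b + s x_a`,
`τ x_c = x_c + t x_b + u x_a` has `τ x_a ∈ W₃`, `τ x_b ∈ W₂`, `τ x_c ∈ W₁`, hence
`τ(x_a^i x_b^j x_c^l) ∈ W₃^i W₂^j W₁^l ⊆ W_{3i+2j+l}` — so `τ(I₆) ⊆ I₆` in EVERY characteristic
(`map_I6_le`); for the `J₄` datum (`σ x_b = x_b + x_a`, `σ x_c = x_c + x_b`; `σ⁻¹ x_b = x_b − x_a`,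
`σ⁻¹ x_c = x_c − x_b + x_a`) this gives `σ(I₆) = I₆` (`map_I6_eq`), `g • I₆ = I₆` on `⟨σ⟩` (`smul_I6_eq`)
and VERBATIM the hypothesis `hρ` of `IsBlowup.liftAction` (`idealSheaf_I6_comap`); finally
`I6_blowup_integral_proper_birational`.
-/

-- single-problem summit: the doubled namespace component `ResolutionOfSingularities` is forced
set_option linter.dupNamespace false

noncomputable section

open CategoryTheory AlgebraicGeometry MvPolynomial
open scoped Pointwise
open Literature.AlgebraicGeometry.Resolution

namespace Summit.ResolutionOfSingularities.ResolutionOfSingularities.Theorems.WildQuotientResolution.JordanFour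

section Weights

variable (k : Type) [Field k] (n : ℕ) (a b c : Fin n)

/-- **Weight ideals multiply**: `W_v · W_w ⊆ W_{v+w}` for the `(3,2,1)`-weight ideals
`W_w = (x_a^i x_b^j x_c^l : 3i + 2j + l ≥ w)`. [folklore] -/
theorem span_weight_mul_le (v w : ℕ) :
    Ideal.span {x : MvPolynomial (Fin n) k | ∃ i j l : ℕ, v ≤ 3 * i + 2 * j + l ∧
        x = X a ^ i * X b ^ j * X c ^ l} *
      Ideal.span {x : MvPolynomial (Fin n) k | ∃ i j l : ℕ, w ≤ 3 * i + 2 * j + l ∧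
        x = X a ^ i * X b ^ j * X c ^ l} ≤
      Ideal.span {x : MvPolynomial (Fin n) k | ∃ i j l : ℕ, v + w ≤ 3 * i + 2 * j + l ∧
        x = X a ^ i * X b ^ j * X c ^ l} := by
  rw [Ideal.span_mul_span']
  refine Ideal.span_le.2 ?_
  rintro _ ⟨x, ⟨i, j, l, hw, rfl⟩, y, ⟨i', j', l', hw', rfl⟩, rfl⟩
  refine Ideal.subset_span ⟨i + i', j + j', l + l', by omega, ?_⟩
  ring

/-- **Powers of weight ideals**: `W_v^i ⊆ W_{v i}`. [folklore] -/
theorem span_weight_pow_le (v : ℕ) : ∀ i : ℕ,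
    Ideal.span {x : MvPolynomial (Fin n) k | ∃ i j l : ℕ, v ≤ 3 * i + 2 * j + l ∧
        x = X a ^ i * X b ^ j * X c ^ l} ^ i ≤
      Ideal.span {x : MvPolynomial (Fin n) k | ∃ i' j l : ℕ, v * i ≤ 3 * i' + 2 * j + l ∧
        x = X a ^ i' * X b ^ j * X c ^ l}
  | 0 => by
    rw [pow_zero, Ideal.one_eq_top, top_le_iff, Ideal.eq_top_iff_one]
    exact Ideal.subset_span ⟨0, 0, 0, by omega, by simp⟩
  | i + 1 => by
    rw [pow_succ]
    refine (Ideal.mul_mono_left (span_weight_pow_le v i)).trans ?_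
    refine (span_weight_mul_le k n a b c (v * i) v).trans (le_of_eq ?_)
    rw [Nat.mul_succ]

/-- **Weight ideals decrease**: `W_v ⊆ W_w` for `w ≤ v`. [folklore] -/
theorem span_weight_mono {v w : ℕ} (h : w ≤ v) :
    Ideal.span {x : MvPolynomial (Fin n) k | ∃ i j l : ℕ, v ≤ 3 * i + 2 * j + l ∧
        x = X a ^ i * X b ^ j * X c ^ l} ≤
      Ideal.span {x : MvPolynomial (Fin n) k | ∃ i j l : ℕ, w ≤ 3 * i + 2 * j + l ∧
        x = X a ^ i * X b ^ j * X c ^ l} := by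
  refine Ideal.span_mono ?_
  rintro _ ⟨i, j, l, hw, rfl⟩
  exact ⟨i, j, l, by omega, rfl⟩

/-- **`W₆ ⊆ I₆`**: every monomial `x_a^i x_b^j x_c^l` of weight `3i + 2j + l ≥ 6` is a multiple of one of
the eight generators of record. [folklore] -/
theorem span_weight_six_le_I6 :
    Ideal.span {x : MvPolynomial (Fin n) k | ∃ i j l : ℕ, 6 ≤ 3 * i + 2 * j + l ∧
        x = X a ^ i * X b ^ j * X c ^ l} ≤
      Ideal.span (Set.range (![X a ^ 2, X a * X b ^ 2, X a * X b * X c, X a * X c ^ 3, X b ^ 3,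
        X b ^ 2 * X c ^ 2, X b * X c ^ 4, X c ^ 6] : Fin 8 → MvPolynomial (Fin n) k)) := by
  refine Ideal.span_le.2 ?_
  rintro _ ⟨i, j, l, hw, rfl⟩
  -- a generator `g_q` with `x = g_q * rest`
  have hgen : ∀ (q : Fin 8) (rest : MvPolynomial (Fin n) k),
      (![X a ^ 2, X a * X b ^ 2, X a * X b * X c, X a * X c ^ 3, X b ^ 3, X b ^ 2 * X c ^ 2,
        X b * X c ^ 4, X c ^ 6] : Fin 8 → MvPolynomial (Fin n) k) q * rest ∈
      Ideal.span (Set.range (![X a ^ 2, X a * X b ^ 2, X a * X b * X c, X a * X c ^ 3, X b ^ 3,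
        X b ^ 2 * X c ^ 2, X b * X c ^ 4, X c ^ 6] : Fin 8 → MvPolynomial (Fin n) k)) :=
    fun q rest => Ideal.mul_mem_right _ _ (Ideal.subset_span ⟨q, rfl⟩)
  rcases Nat.lt_or_ge i 2 with hi | hi
  · interval_cases i
    · -- `i = 0`: `2j + l ≥ 6`
      rcases Nat.lt_or_ge j 3 with hj | hj
      · interval_cases j
        · obtain ⟨l', rfl⟩ := Nat.exists_eq_add_of_le (by omega : 6 ≤ l)
          have e : (X a ^ 0 * X b ^ 0 * X c ^ (6 + l') : MvPolynomial (Fin n) k) =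
              X c ^ 6 * X c ^ l' := by ring
          rw [e]; exact hgen 7 _
        · obtain ⟨l', rfl⟩ := Nat.exists_eq_add_of_le (by omega : 4 ≤ l)
          have e : (X a ^ 0 * X b ^ 1 * X c ^ (4 + l') : MvPolynomial (Fin n) k) =
              X b * X c ^ 4 * X c ^ l' := by ring
          rw [e]; exact hgen 6 _
        · obtain ⟨l', rfl⟩ := Nat.exists_eq_add_of_le (by omega : 2 ≤ l)
          have e : (X a ^ 0 * X b ^ 2 * X c ^ (2 + l') : MvPolynomial (Fin n) k) =
              X b ^ 2 * X c ^ 2 * X c ^ l' := by ring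
          rw [e]; exact hgen 5 _
      · obtain ⟨j', rfl⟩ := Nat.exists_eq_add_of_le hj
        have e : (X a ^ 0 * X b ^ (3 + j') * X c ^ l : MvPolynomial (Fin n) k) =
            X b ^ 3 * (X b ^ j' * X c ^ l) := by ring
        rw [e]; exact hgen 4 _
    · -- `i = 1`: `2j + l ≥ 3`
      rcases Nat.lt_or_ge j 2 with hj | hj
      · interval_cases j
        · obtain ⟨l', rfl⟩ := Nat.exists_eq_add_of_le (by omega : 3 ≤ l)
          have e : (X a ^ 1 * X b ^ 0 * X c ^ (3 + l') : MvPolynomial (Fin n) k) =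
              X a * X c ^ 3 * X c ^ l' := by ring
          rw [e]; exact hgen 3 _
        · obtain ⟨l', rfl⟩ := Nat.exists_eq_add_of_le (by omega : 1 ≤ l)
          have e : (X a ^ 1 * X b ^ 1 * X c ^ (1 + l') : MvPolynomial (Fin n) k) =
              X a * X b * X c * X c ^ l' := by ring
          rw [e]; exact hgen 2 _
      · obtain ⟨j', rfl⟩ := Nat.exists_eq_add_of_le hj
        have e : (X a ^ 1 * X b ^ (2 + j') * X c ^ l : MvPolynomial (Fin n) k) =
            X a * X b ^ 2 * (X b ^ j' * X c ^ l) := by ring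
        rw [e]; exact hgen 1 _
  · obtain ⟨i', rfl⟩ := Nat.exists_eq_add_of_le hi
    have e : (X a ^ (2 + i') * X b ^ j * X c ^ l : MvPolynomial (Fin n) k) =
        X a ^ 2 * (X a ^ i' * X b ^ j * X c ^ l) := by ring
    rw [e]; exact hgen 0 _

/-- **A weight-raising endomorphism maps monomials of weight `≥ 3i+2j+l` into `W_{3i+2j+l}`**:
if `τ x_a = x_a`, `τ x_b = x_b + s x_a`, `τ x_c = x_c + t x_b + u x_a`, then
`τ(x_a^i x_b^j x_c^l) ∈ W₃^i W₂^j W₁^l ⊆ W_{3i+2j+l}`. [folklore] -/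
theorem map_monomial_mem_span_weight (τ : MvPolynomial (Fin n) k →+* MvPolynomial (Fin n) k)
    (s t u : MvPolynomial (Fin n) k) (ha : τ (X a) = X a) (hb : τ (X b) = X b + s * X a)
    (hc : τ (X c) = X c + t * X b + u * X a) (i j l : ℕ) :
    τ (X a ^ i * X b ^ j * X c ^ l) ∈
      Ideal.span {x : MvPolynomial (Fin n) k | ∃ i' j' l' : ℕ, 3 * i + 2 * j + l ≤ 3 * i' + 2 * j' + l' ∧
        x = X a ^ i' * X b ^ j' * X c ^ l'} := by
  have hXa : ∀ w, w ≤ 3 → (X a : MvPolynomial (Fin n) k) ∈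
      Ideal.span {x : MvPolynomial (Fin n) k | ∃ i j l : ℕ, w ≤ 3 * i + 2 * j + l ∧
        x = X a ^ i * X b ^ j * X c ^ l} :=
    fun w hw => Ideal.subset_span ⟨1, 0, 0, by omega, by simp⟩
  have hXb : ∀ w, w ≤ 2 → (X b : MvPolynomial (Fin n) k) ∈
      Ideal.span {x : MvPolynomial (Fin n) k | ∃ i j l : ℕ, w ≤ 3 * i + 2 * j + l ∧
        x = X a ^ i * X b ^ j * X c ^ l} :=
    fun w hw => Ideal.subset_span ⟨0, 1, 0, by omega, by simp⟩
  have hXc : (X c : MvPolynomial (Fin n) k) ∈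
      Ideal.span {x : MvPolynomial (Fin n) k | ∃ i j l : ℕ, 1 ≤ 3 * i + 2 * j + l ∧
        x = X a ^ i * X b ^ j * X c ^ l} :=
    Ideal.subset_span ⟨0, 0, 1, by omega, by simp⟩
  have h3 : τ (X a) ∈ Ideal.span {x : MvPolynomial (Fin n) k | ∃ i j l : ℕ, 3 ≤ 3 * i + 2 * j + l ∧
        x = X a ^ i * X b ^ j * X c ^ l} := by
    rw [ha]; exact hXa 3 le_rfl
  have h2 : τ (X b) ∈ Ideal.span {x : MvPolynomial (Fin n) k | ∃ i j l : ℕ, 2 ≤ 3 * i + 2 * j + l ∧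
        x = X a ^ i * X b ^ j * X c ^ l} := by
    rw [hb]
    exact Ideal.add_mem _ (hXb 2 le_rfl) (Ideal.mul_mem_left _ _ (hXa 2 (by omega)))
  have h1 : τ (X c) ∈ Ideal.span {x : MvPolynomial (Fin n) k | ∃ i j l : ℕ, 1 ≤ 3 * i + 2 * j + l ∧
        x = X a ^ i * X b ^ j * X c ^ l} := by
    rw [hc]
    exact Ideal.add_mem _ (Ideal.add_mem _ hXc (Ideal.mul_mem_left _ _ (hXb 1 (by omega))))
      (Ideal.mul_mem_left _ _ (hXa 1 (by omega)))
  rw [map_mul, map_mul, map_pow, map_pow, map_pow]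
  have hmem := Ideal.mul_mem_mul (Ideal.mul_mem_mul (Ideal.pow_mem_pow h3 i) (Ideal.pow_mem_pow h2 j))
    (Ideal.pow_mem_pow h1 l)
  have hle := (Ideal.mul_mono (Ideal.mul_mono (span_weight_pow_le k n a b c 3 i)
      (span_weight_pow_le k n a b c 2 j)) (span_weight_pow_le k n a b c 1 l)).trans
    ((Ideal.mul_mono_left (span_weight_mul_le k n a b c (3 * i) (2 * j))).trans
      (span_weight_mul_le k n a b c (3 * i + 2 * j) (1 * l)))
  simpa only [one_mul] using hle hmem

set_option maxHeartbeats 400000 in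
/-- **`τ(I₆) ⊆ I₆`** for every ring endomorphism `τ` of `k[x₁,…,xₙ]` with `τ x_a = x_a`,
`τ x_b = x_b + s·x_a`, `τ x_c = x_c + t·x_b + u·x_a` — ANY characteristic. [folklore] -/
theorem map_I6_le (τ : MvPolynomial (Fin n) k →+* MvPolynomial (Fin n) k)
    (s t u : MvPolynomial (Fin n) k) (ha : τ (X a) = X a) (hb : τ (X b) = X b + s * X a)
    (hc : τ (X c) = X c + t * X b + u * X a) :
    Ideal.map τ (Ideal.span (Set.range (![X a ^ 2, X a * X b ^ 2, X a * X b * X c, X a * X c ^ 3,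
        X b ^ 3, X b ^ 2 * X c ^ 2, X b * X c ^ 4, X c ^ 6] : Fin 8 → MvPolynomial (Fin n) k))) ≤
      Ideal.span (Set.range (![X a ^ 2, X a * X b ^ 2, X a * X b * X c, X a * X c ^ 3, X b ^ 3,
        X b ^ 2 * X c ^ 2, X b * X c ^ 4, X c ^ 6] : Fin 8 → MvPolynomial (Fin n) k)) := by
  rw [Ideal.map_span, Ideal.span_le]
  rintro _ ⟨_, ⟨q, rfl⟩, rfl⟩
  -- each generator is a monomial `x_a^i x_b^j x_c^l` of weight ≥ 6
  have key : ∀ i j l : ℕ, 6 ≤ 3 * i + 2 * j + l → τ (X a ^ i * X b ^ j * X c ^ l) ∈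
      Ideal.span (Set.range (![X a ^ 2, X a * X b ^ 2, X a * X b * X c, X a * X c ^ 3, X b ^ 3,
        X b ^ 2 * X c ^ 2, X b * X c ^ 4, X c ^ 6] : Fin 8 → MvPolynomial (Fin n) k)) :=
    fun i j l hw => span_weight_six_le_I6 k n a b c (span_weight_mono k n a b c hw
      (map_monomial_mem_span_weight k n a b c τ s t u ha hb hc i j l))
  fin_cases q
  · simpa using key 2 0 0 (by norm_num)
  · simpa using key 1 2 0 (by norm_num)
  · simpa using key 1 1 1 (by norm_num)
  · simpa using key 1 0 3 (by norm_num)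
  · simpa using key 0 3 0 (by norm_num)
  · simpa using key 0 2 2 (by norm_num)
  · simpa using key 0 1 4 (by norm_num)
  · simpa using key 0 0 6 (by norm_num)

end Weights

end Summit.ResolutionOfSingularities.ResolutionOfSingularities.Theorems.WildQuotientResolution.JordanFour

end
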